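import Summits.HodgeConjecture.HodgeConjecture.Theorems.GenericDivisibilityGenericDivisibilityBoundedSupportedTop
import Literature.AlgebraicGeometry.HodgeTheory.SupportedClassesOfChowZeroSupportedAboveDim
import HarnessLib

/-!
# Route GenericDivisibility — crux C2 `GenericDivisibilityBounded` (stmt-HodgeConjecture-18467):
# the sector "`CH₀(X)` supported in dimension `< 2p = dim X`" of the heart and of C2

Line `finite-level-bootstrap`, lead c4 (cycle 6). Sorry-free, definition-free. Sequel of
`…GenericDivisibilityBoundedSupportedTop` (the heart and C2 hold on every smooth projective `X` with
`N¹H^{2p}(X(ℂ);ℂ) = H^{2p}(X(ℂ);ℂ)`) and of c3's `…SmallChowZero` (the sector `CH₀ ⊗ ℚ` of rank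
`≤ 1`). The tree's theorem `supportedClasses_eq_top_of_hasChowZeroSupportedInDimLE_of_lt`
(Bloch–Srinivas decomposition of the diagonal `mΔ = Z' + Z''`, `Z' ⊆ T × X`, `Z'' ⊆ X × W`, run
through the unconditional complex-orientation Gysin formalism, with Andreotti–Frankel on a
resolution of `W` to kill the `Z''`-part in degrees `> dim W`) says: if `CH₀(X)` is supported on a
closed algebraic subset of dimension `≤ d` (`Barriers.HodgeConjecture.HasChowZeroSupportedInDimLE X d`)
then `N¹Hˡ(X(ℂ);ℂ) = Hˡ(X(ℂ);ℂ)` for every `l > d`. With `l = 2p = dim X` this needs only `d ≤ 2p - 1`: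
**`CH₀(X)` supported on a DIVISOR** (the Chow-theoretic shadow of `h^{2p,0}(X) = 0`, Bloch–Srinivas
1983 Thm. 1 (ii); conversely Bloch's conjecture).

## Main results

* `genericDivisibilityBounded_levelClean_of_hasChowZeroSupportedInDimLE` — **the heart of the line at
  EVERY prime and level on every smooth projective `n`-fold whose `CH₀` is supported in dimension
  `≤ d < k`**, in degree `k` (so `k = n`, `d = n - 1` for the crux);
* `genericDivisibilityBounded_at_of_hasChowZeroSupportedInDimLE` — **C2 there**;
* `stub_heartOfChowZeroSupportedBelowTop` — the registered sub-goal of the crux item (degree `2p`,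
  `d < 2p`), verbatim.

This strictly enlarges the `CH₀`-rank-`≤ 1` sector (`d = 0`): e.g. `S × Y` with `CH₀(S) = ℤ`
(`S` rational or Enriques) and `Y` arbitrary has `CH₀` supported on `{pt} × Y`, of dimension
`2p - 2 ≤ 2p - 1`, while `CH₀(S × Y)` is as large as `CH₀(Y)`.

References: [BlochSrinivas1983] Thm. 1 and its proof; [VoisinHodgeII2003] Thm. 10.17, Cor. 10.21,
Thm. 1.22; [BlochOgus1974ENS] (3.8); [Dimca1992] Ch. 1 Cor. (6.10).
-/

set_option linter.dupNamespace false

noncomputable section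

namespace Summit.HodgeConjecture.HodgeConjecture.Theorems

open CategoryTheory AlgebraicGeometry
open Literature.AlgebraicGeometry.Motives Literature.AlgebraicGeometry.HodgeTheory
  Literature.AlgebraicTopology.SingularHomology
open Literature.Barriers.HodgeConjecture (HasChowZeroSupportedInDimLE)
open Summit.HodgeConjecture.HodgeConjecture.Theses.GenericDivisibility

/-- Restriction `H^k(X(ℂ);ℤ) → H^k((X∖Z)(ℂ);ℤ)`, the very term of the route decls (notation only). -/
local notation3 (prettyPrint := false) "Res[" X ", " Z ", " k "]" =>
  singularCohomology.map ℤ ℤ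
    (⟨Subtype.val, continuous_subtype_val⟩ : C(complexPointsCompl X Z, ComplexPoints X)) k

/-- **The heart at EVERY prime `ℓ` and level `s`, in degree `k`, on a smooth projective `n`-fold whose
`CH₀` is supported in dimension `≤ d < k`** ("`D'(ℓ^s, z) ⇒ ∃ w, z - ℓ • w ∈ GT`" with `w = 0`):
`N¹Hᵏ(X(ℂ);ℂ) = Hᵏ(X(ℂ);ℂ)` by Bloch–Srinivas + Andreotti–Frankel
(`supportedClasses_eq_top_of_hasChowZeroSupportedInDimLE_of_lt`), then the `N¹ = ⊤` sector
(`genericDivisibilityBounded_levelClean_of_supportedClasses_eq_top`). For the crux: `k = n = 2p`,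
`d = 2p - 1` — `CH₀` supported on a divisor. [cite: BlochSrinivas1983, Thm. 1 and its proof]
[cite: VoisinHodgeII2003, Thm. 10.17, Cor. 10.21 and Thm. 1.22] -/
theorem genericDivisibilityBounded_levelClean_of_hasChowZeroSupportedInDimLE
    {n : ℕ} {X : SchemeOver ℂ} (hX : IsSmoothProjective n X) {d k : ℕ} (hdk : d < k)
    (hW : HasChowZeroSupportedInDimLE X d) (ℓ s : ℕ) :
    ∀ z : singularCohomology ℤ ℤ (ComplexPoints X) k,
      (∃ Z : Set X.left, IsClosed Z ∧ Z ≠ Set.univ ∧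
        ∃ (y : singularCohomology ℤ ℤ (complexPointsCompl X Z) k) (M : ℕ), 1 ≤ M ∧
          M • (Res[X, Z, k] z - ℓ ^ s • y) = 0) →
      ∃ w : singularCohomology ℤ ℤ (ComplexPoints X) k, ∃ Z : Set X.left, IsClosed Z ∧
        Z ≠ Set.univ ∧ ∃ N : ℕ, 1 ≤ N ∧ N • Res[X, Z, k] (z - ℓ • w) = 0 :=
  genericDivisibilityBounded_levelClean_of_supportedClasses_eq_top hX (by omega)
    (supportedClasses_eq_top_of_hasChowZeroSupportedInDimLE_of_lt hX hW hdk) ℓ s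

/-- **C2 in degree `k` on a smooth projective `n`-fold whose `CH₀` is supported in dimension
`≤ d < k`** (in the crux's shape; the divisibility hypothesis is not used).
[cite: BlochSrinivas1983, Thm. 1 and its proof] [cite: VoisinHodgeII2003, Thm. 10.17 and Cor. 10.21] -/
theorem genericDivisibilityBounded_at_of_hasChowZeroSupportedInDimLE
    {n : ℕ} {X : SchemeOver ℂ} (hX : IsSmoothProjective n X) {d k : ℕ} (hdk : d < k)
    (hW : HasChowZeroSupportedInDimLE X d) :
    ∀ z : singularCohomology ℤ ℤ (ComplexPoints X) k,
      (∀ m : ℕ, 1 ≤ m → ∃ Z : Set X.left, IsClosed Z ∧ Z ≠ Set.univ ∧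
        ∃ y : singularCohomology ℤ ℤ (complexPointsCompl X Z) k, m • y = Res[X, Z, k] z) →
      singularCohomology.ringChange (Int.castRingHom ℂ) (ComplexPoints X) k z ∈
        supportedClasses X k 1 :=
  genericDivisibilityBounded_at_of_supportedClasses_eq_top
    (supportedClasses_eq_top_of_hasChowZeroSupportedInDimLE_of_lt hX hW hdk)

/-- **C2 at every smooth projective `2p`-fold whose `CH₀` is supported on a divisor** (`d = 2p - 1`,
`p ≥ 1`): the Chow-theoretic shadow of `h^{2p,0} = 0`. [cite: BlochSrinivas1983, Thm. 1 and its proof]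
[cite: VoisinHodgeII2003, Thm. 10.17 and Cor. 10.21] -/
theorem genericDivisibilityBounded_at_of_hasChowZeroSupportedOnDivisor {p : ℕ} {X : SchemeOver ℂ}
    (hp : 1 ≤ p) (hX : IsSmoothProjective (2 * p) X) (hW : HasChowZeroSupportedInDimLE X (2 * p - 1)) :
    ∀ z : singularCohomology ℤ ℤ (ComplexPoints X) (2 * p),
      (∀ m : ℕ, 1 ≤ m → ∃ Z : Set X.left, IsClosed Z ∧ Z ≠ Set.univ ∧
        ∃ y : singularCohomology ℤ ℤ (complexPointsCompl X Z) (2 * p), m • y = Res[X, Z, 2 * p] z) →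
      singularCohomology.ringChange (Int.castRingHom ℂ) (ComplexPoints X) (2 * p) z ∈
        supportedClasses X (2 * p) 1 :=
  genericDivisibilityBounded_at_of_hasChowZeroSupportedInDimLE hX (k := 2 * p) (by omega) hW

/-- **Registered sub-goal `stub_heartOfChowZeroSupportedBelowTop` of stmt-HodgeConjecture-18467
(lead c4): the heart of line `finite-level-bootstrap` at every `(ℓ, s)` on every smooth projective
`2p`-fold (`p ≥ 1`) whose `CH₀` is supported in dimension `≤ d < 2p`**, verbatim.
[cite: BlochSrinivas1983, Thm. 1 and its proof] [cite: VoisinHodgeII2003, Thm. 10.17, Cor. 10.21 and Thm. 1.22] -/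
theorem stub_heartOfChowZeroSupportedBelowTop : ∀ ⦃p : ℕ⦄ ⦃X : SchemeOver ℂ⦄, 1 ≤ p → IsSmoothProjective (2 * p) X → ∀ d : ℕ, d < 2 * p → HasChowZeroSupportedInDimLE X d → ∀ ℓ s : ℕ, ∀ z : singularCohomology ℤ ℤ (ComplexPoints X) (2 * p), (∃ Z : Set X.left, IsClosed Z ∧ Z ≠ Set.univ ∧ ∃ (y : singularCohomology ℤ ℤ (complexPointsCompl X Z) (2 * p)) (M : ℕ), 1 ≤ M ∧ M • (singularCohomology.map ℤ ℤ (⟨Subtype.val, continuous_subtype_val⟩ : C(complexPointsCompl X Z, ComplexPoints X)) (2 * p) z - ℓ ^ s • y) = 0) → ∃ w : singularCohomology ℤ ℤ (ComplexPoints X) (2 * p), ∃ Z : Set X.left, IsClosed Z ∧ Z ≠ Set.univ ∧ ∃ N : ℕ, 1 ≤ N ∧ N • singularCohomology.map ℤ ℤ (⟨Subtype.val, continuous_subtype_val⟩ : C(complexPointsCompl X Z, ComplexPoints X)) (2 * p) (z - ℓ • w) = 0 :=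
  fun _ _ _ hX _ hd hW ℓ s ↦
    genericDivisibilityBounded_levelClean_of_hasChowZeroSupportedInDimLE hX hd hW ℓ s

end Summit.HodgeConjecture.HodgeConjecture.Theorems

end
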